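import Summits.BirchSwinnertonDyer.BirchSwinnertonDyer.Theorems.ResidualThetaTransportAtTwoHeckeThetaPartnerAdicAtTwoHeckeThetaAssembly
import Summits.BirchSwinnertonDyer.BirchSwinnertonDyer.Theorems.ResidualThetaTransportAtTwoHeckeThetaHigherWeightClassSeries
import HarnessLib

/-!
# Hecke's theta series of a weight-`(e+1)` Größencharakter is a cusp form on `Γ₀(|d_K|·N𝔪)` (`e` odd)
# (toward X_k for `Ribet1977_cmNewform_gamma0_of_isGrossencharakter`, stmt-BirchSwinnertonDyer-24141)

Order-`e` analogue of `…HeckeThetaAssembly` (the case `e = 1`).  THEOREMS ONLY.  Prepared by the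
literature-prover seat `bsd-input-ribet77-cm-newform-g0` as EVIDENCE (Summit `Theorems/` is prover-only).

**`exists_heckeTheta_cuspForm_pow`.**  `K` imaginary quadratic with Kronecker character `κ`, `𝔪 ≠ 0, 1`,
`ψ` nonvanishing prime values with the weight-`(e+1)` Größencharakter relation mod `𝔪`
(`ψ̃((b)) = ψ̃((c)) σ(b/c)ᵉ`) and `ψ̃((n)) = (d_K/n) nᵉ` for odd `n` prime to `|d_K| N𝔪`, `e` odd.
Then there is `g ∈ S_{e+1}(Γ₀(|d_K|·N𝔪))` with `g(τ) = Σ_n (Σ_{N𝔞 = n} ψ̃_𝔪(𝔞)) qⁿ`.  Assembly exactly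
as at weight two: `f = Σ_c ((2πi)ᵉ w ψ̃(𝔞_c))⁻¹ F_{𝔞_c}` lies in the span `Vₑ`
(`classThetaPow_mem_span`), satisfies `f ∣_{e+1} γ = f` on `Γ₀` (`classThetaPow_moeb`,
`kappa_mul_chiPow_eq_one`), hence is a cusp form (`Literature…exists_cuspForm_of_mem_lineSpan`), and its
`q`-expansion is computed by `hasSum_classThetaPow_nat` and `ThetaClassWeighted.sum_weighted_norm_eq`.

BSD is not proved by this file.
-/

set_option autoImplicit false
set_option linter.dupNamespace false

noncomputable section

open scoped NumberField ComplexConjugate Real MatrixGroups UpperHalfPlane ModularForm nonZeroDivisors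
open NumberField Module Matrix Complex Filter IsDedekindDomain CongruenceSubgroup

namespace Summit.BirchSwinnertonDyer.BirchSwinnertonDyer.Theorems.HeckeTheta

open Literature.Analysis.SpecialFunctions
open Literature.NumberTheory.ModularForms.BinaryTheta
open Literature.NumberTheory.Automorphic (siegelUpperHalfSpace mem_siegelUpperHalfSpace_iff)
open Literature.NumberTheory.LFunctions (idealPow rayClassCoeff exists_isCoprime_mk0_eq)
open Literature.NumberTheory.EllipticCurves.ModularForms (rayClassCoeff_mul_of_ne_bot)

variable {K : Type} [Field K] [NumberField K]

/-! ### The cusp form -/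

/-- **Hecke's weight-`(e+1)` theta series `θ_ψ ∈ S_{e+1}(Γ₀(|d_K|·N𝔪))` (`e` odd) with
`θ_ψ(τ) = Σ_n (Σ_{N𝔞 = n} ψ̃_𝔪(𝔞)) qⁿ`** (order-`e` analogue of `exists_heckeTheta_cuspForm`). -/
theorem exists_heckeTheta_cuspForm_pow (hK : finrank ℚ K = 2) [IsTotallyComplex K] (σ : K →+* ℂ)
    {κ : DirichletCharacter ℂ (discr K).natAbs} (hprim : κ.IsPrimitive) (hodd : κ.Odd)
    (hquad : κ ^ 2 = 1) (hκJ : ∀ n : ℕ, Odd n → κ n = (jacobiSym (discr K) n : ℂ))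
    (hζ : ∀ s : ℂ, 1 < s.re → NumberField.dedekindZeta K s = riemannZeta s * LSeries (fun n => κ n) s)
    {𝔪 : Ideal (𝓞 K)} (h𝔪 : 𝔪 ≠ ⊥) (h𝔪1 : 𝔪 ≠ ⊤) {ψ : HeightOneSpectrum (𝓞 K) → ℂ} {e : ℕ} (he : Odd e)
    (hψ0 : ∀ v : HeightOneSpectrum (𝓞 K), ¬ 𝔪 ≤ v.asIdeal → ψ v ≠ 0)
    (hψ : ∀ b c : 𝓞 K, b ≠ 0 → c ≠ 0 → IsCoprime (Ideal.span {c}) 𝔪 → b - c ∈ 𝔪 →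
      idealPow K ψ (Ideal.span {b}) = idealPow K ψ (Ideal.span {c}) * σ ((b : K) / c) ^ e)
    (hneb : ∀ n : ℕ, Odd n → n.Coprime ((discr K).natAbs * Ideal.absNorm 𝔪) →
      idealPow K ψ (Ideal.span {(n : 𝓞 K)}) = (jacobiSym (discr K) n : ℂ) * (n : ℂ) ^ e)
    [NeZero ((discr K).natAbs * Ideal.absNorm 𝔪)] :
    ∃ g : CuspForm (Gamma0 ((discr K).natAbs * Ideal.absNorm 𝔪)) ((e + 1 : ℕ) : ℤ), ∀ τ : ℍ,
      HasSum (fun n : ℕ => (∑ᶠ J ∈ {J : Ideal (𝓞 K) | Ideal.absNorm J = n}, rayClassCoeff 𝔪 ψ J) *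
        cexp (2 * π * I * (τ : ℂ)) ^ n) (g τ) := by
  classical
  have hM : Ideal.absNorm 𝔪 ≠ 0 := by rw [Ne, Ideal.absNorm_eq_zero_iff]; exact h𝔪
  haveI hfu : Finite (𝓞 K)ˣ := finite_units hK
  have hw : ((Nat.card (𝓞 K)ˣ : ℕ) : ℂ) ≠ 0 := by exact_mod_cast Nat.card_pos.ne'
  have h2πI : (2 * π * I : ℂ) ≠ 0 := by simp [Real.pi_ne_zero]
  have h2πIe : (2 * π * I : ℂ) ^ e ≠ 0 := pow_ne_zero _ h2πI
  -- class representatives prime to `𝔪`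
  choose 𝔞r h𝔞r0 h𝔞r using fun c : ClassGroup (𝓞 K) => exists_isCoprime_mk0_eq (K := K) h𝔪 c
  have hrcc0 : ∀ c, rayClassCoeff 𝔪 ψ (𝔞r c) ≠ 0 := fun c =>
    rayClassCoeff_ne_zero_of_isCoprime hψ0 (h𝔞r0 c) (h𝔞r c).1
  have h𝔟0 : ∀ c, 𝔞r c * 𝔪 ≠ ⊥ := fun c => mul_ne_zero (h𝔞r0 c) h𝔪
  -- Gram data of `𝔟_c = 𝔞_c 𝔪`
  choose bc Bc hBc hsymmc h00c h11c hdetc hposc using fun c => exists_gram hK σ (h𝔟0 c)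
  have huc : ∀ c, (fun i => σ ((bc c i : 𝓞 K) : K)) ⬝ᵥ (((Bc c).map ((↑) : ℤ → ℂ)).adjugate *ᵥ
      fun i => σ ((bc c i : 𝓞 K) : K)) = 0 := fun c =>
    dotProduct_adjugate_embedding_eq_zero σ (bc c) (hBc c)
      (by rw [Ne, Ideal.absNorm_eq_zero_iff]; exact h𝔟0 c)
  haveI hfin : ∀ c, Fintype (𝓞 K ⧸ 𝔞r c * 𝔪) := fun c =>
    @Fintype.ofFinite _ (Ideal.finiteQuotientOfFreeOfNeBot _ (h𝔟0 c))
  have hmem : ∀ c (x₀ : 𝓞 K), x₀ ∈ 𝔞r c → (Ideal.absNorm 𝔪 : 𝓞 K) * x₀ ∈ 𝔞r c * 𝔪 :=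
    fun c x₀ h => by simpa only [mul_comm x₀] using Ideal.mul_mem_mul h (Ideal.absNorm_mem 𝔪)
  -- the coset theta functions
  obtain ⟨Θ, hΘdef⟩ : ∃ Θ : ClassGroup (𝓞 K) → 𝓞 K → ℍ → ℂ, Θ = fun c x₀ (τ : ℍ) =>
      if h : x₀ ∈ 𝔞r c then iteratedDeriv e (fun s : ℂ => riemannThetaChar
        (fun i => (((bc c).equivFun ⟨(Ideal.absNorm 𝔪 : 𝓞 K) * x₀, hmem c x₀ h⟩ i : ℤ) : ℂ) /
          (Ideal.absNorm 𝔪 : ℕ)) 0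
        ((((Ideal.absNorm 𝔪 : ℕ) : ℂ) * (τ : ℂ)) • (Bc c).map ((↑) : ℤ → ℂ))
        (s • fun i => σ (((bc c) i : 𝓞 K) : K))) 0
      else 0 := ⟨_, rfl⟩
  have hΘ : ∀ c, ∀ x₀ ∈ 𝔞r c, ∀ k : Fin 2 → ℤ,
      (((bc c).equivFun.symm k : ↥(𝔞r c * 𝔪)) : 𝓞 K) = (Ideal.absNorm 𝔪 : 𝓞 K) * x₀ →
      ∀ τ : ℍ, Θ c x₀ τ = iteratedDeriv e (fun s : ℂ => riemannThetaChar
        (fun i => (k i : ℂ) / (Ideal.absNorm 𝔪 : ℕ)) 0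
        ((((Ideal.absNorm 𝔪 : ℕ) : ℂ) * (τ : ℂ)) • (Bc c).map ((↑) : ℤ → ℂ))
        (s • fun i => σ (((bc c) i : 𝓞 K) : K))) 0 := by
    intro c x₀ hx₀ k hk τ
    have hk' : (bc c).equivFun ⟨(Ideal.absNorm 𝔪 : 𝓞 K) * x₀, hmem c x₀ hx₀⟩ = k := by
      have : (bc c).equivFun.symm k = ⟨_, hmem c x₀ hx₀⟩ := Subtype.ext hk
      rw [← this, LinearEquiv.apply_symm_apply]
    rw [hΘdef]
    simp only [dif_pos hx₀, hk']
  have hΘ0 : ∀ c x₀, x₀ ∉ 𝔞r c → ∀ τ : ℍ, Θ c x₀ τ = 0 := fun c x₀ h τ => by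
    rw [hΘdef]; simp only [dif_neg h]
  have hρ : ∀ c (q : 𝓞 K ⧸ 𝔞r c * 𝔪), Ideal.Quotient.mk (𝔞r c * 𝔪) (Quotient.out q) = q :=
    fun c q => Ideal.Quotient.mk_out q
  -- the class series and the normalised sum over classes
  obtain ⟨F, hFdef⟩ : ∃ F : ClassGroup (𝓞 K) → ℍ → ℂ, F = fun c (τ : ℍ) => ∑ q : 𝓞 K ⧸ 𝔞r c * 𝔪,
      rayClassCoeff 𝔪 ψ (Ideal.span {Quotient.out q}) / σ ((Quotient.out q : 𝓞 K) : K) ^ e *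
        Θ c (Quotient.out q) τ := ⟨_, rfl⟩
  have hF : ∀ c τ, F c τ = ∑ q : 𝓞 K ⧸ 𝔞r c * 𝔪,
      rayClassCoeff 𝔪 ψ (Ideal.span {Quotient.out q}) / σ ((Quotient.out q : 𝓞 K) : K) ^ e *
        Θ c (Quotient.out q) τ := fun c τ => by rw [hFdef]
  obtain ⟨coef, hcoef⟩ : ∃ coef : ClassGroup (𝓞 K) → ℂ, coef = fun c =>
      ((2 * π * I) ^ e * ((Nat.card (𝓞 K)ˣ : ℕ) : ℂ) * rayClassCoeff 𝔪 ψ (𝔞r c))⁻¹ := ⟨_, rfl⟩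
  obtain ⟨f, hfdef⟩ : ∃ f : ℍ → ℂ, f = fun τ : ℍ => ∑ c, coef c * F c τ := ⟨_, rfl⟩
  -- (1) `f` lies in the theta span
  have hfspan : f ∈ Submodule.span ℂ {F : ℍ → ℂ | ∃ (P : Matrix (Fin 2) (Fin 2) ℚ), P.IsSymm ∧
      (P.map (Rat.cast : ℚ → ℝ)).PosDef ∧ ∃ (a b : Fin 2 → ℚ) (u : Fin 2 → ℂ),
        u ⬝ᵥ ((P.map (Rat.cast : ℚ → ℂ)).adjugate *ᵥ u) = 0 ∧ F = fun τ : ℍ =>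
          iteratedDeriv e (fun s : ℂ => riemannThetaChar (fun i => (a i : ℂ)) (fun i => (b i : ℂ))
            ((τ : ℂ) • P.map (Rat.cast : ℚ → ℂ)) (s • u)) 0} := by
    have hfeq : f = ∑ c, coef c • F c := by
      funext τ; rw [hfdef]; simp [Finset.sum_apply]
    rw [hfeq]
    refine Submodule.sum_mem _ fun c _ => Submodule.smul_mem _ _ ?_
    exact classThetaPow_mem_span σ h𝔪 ψ e (𝔞 := 𝔞r c) rfl (bc c) (hsymmc c) (hposc c) (huc c) (Θ c)
      (hΘ c) (hΘ0 c) (fun q => Quotient.out q) (F c) (hF c)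
  -- (2) the law on `Γ₀(|d_K| M)`
  have hinv : ∀ γ : SL(2, ℤ), γ ∈ Gamma0 ((discr K).natAbs * Ideal.absNorm 𝔪) →
      f ∣[((e + 1 : ℕ) : ℤ)] γ = f := by
    intro γ hγ
    obtain ⟨hc, hd⟩ := dvd_and_isCoprime_of_mem_Gamma0 hγ
    have hone := kappa_mul_chiPow_eq_one hK σ hodd hκJ h𝔪 he hψ hneb hd
    funext τ
    rw [ModularForm.SL_slash_apply, ModularGroup.denom_apply]
    have hX : (((γ 1 0 : ℤ) : ℂ) * (τ : ℂ) + ((γ 1 1 : ℤ) : ℂ)) ≠ 0 := by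
      have := UpperHalfPlane.denom_ne_zero γ τ
      rwa [ModularGroup.denom_apply] at this
    have hFc : ∀ c, F c (γ • τ) = (((γ 1 0 : ℤ) : ℂ) * (τ : ℂ) + ((γ 1 1 : ℤ) : ℂ)) ^ (e + 1) * F c τ := by
      intro c
      rw [classThetaPow_moeb hK σ hprim hodd hquad hζ h𝔪 he hψ (𝔞 := 𝔞r c) rfl (h𝔞r0 c) (bc c) (hBc c)
        (hsymmc c) (h00c c) (h11c c) (hdetc c) (hposc c) (Θ c) (hΘ c) (hΘ0 c) (fun q => Quotient.out q)
        (hρ c) (F c) (hF c) hc τ, hone, one_mul]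
    have hfτ : f (γ • τ) = (((γ 1 0 : ℤ) : ℂ) * (τ : ℂ) + ((γ 1 1 : ℤ) : ℂ)) ^ (e + 1) * f τ := by
      rw [hfdef]
      simp only [hFc]
      rw [Finset.mul_sum]
      exact Finset.sum_congr rfl fun c _ => by ring
    rw [hfτ, _root_.zpow_neg, zpow_natCast]
    field_simp
  -- (3) the cusp form
  obtain ⟨g, hg⟩ := exists_cuspForm_of_mem_lineSpan ((discr K).natAbs * Ideal.absNorm 𝔪) he.pos hfspan hinv
  refine ⟨g, fun τ => ?_⟩
  rw [hg, hfdef]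
  -- (4) the `q`-expansion
  have hFs : ∀ c, HasSum (fun n : ℕ => ((2 * π * I) ^ e * ∑ᶠ x : {x : 𝓞 K // x ∈ 𝔞r c ∧
      Ideal.absNorm (Ideal.span {x}) = n * Ideal.absNorm (𝔞r c)}, rayClassCoeff 𝔪 ψ (Ideal.span {x.1})) *
        cexp (2 * π * I * (τ : ℂ)) ^ n) (F c τ) := fun c =>
    hasSum_classThetaPow_nat hK σ h𝔪 h𝔪1 he.pos.ne' hψ (𝔞 := 𝔞r c) rfl (h𝔞r0 c) (bc c) (hBc c) (hsymmc c)
      (hposc c) (Θ c) (hΘ c) (hΘ0 c) (fun q => Quotient.out q) (hρ c) (F c) (hF c) τ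
  have hsum := hasSum_sum (s := Finset.univ) fun c _ => (hFs c).mul_left (coef c)
  refine hsum.congr_fun fun n => ?_
  rw [show ∑ c, coef c * (((2 * π * I) ^ e * ∑ᶠ x : {x : 𝓞 K // x ∈ 𝔞r c ∧
      Ideal.absNorm (Ideal.span {x}) = n * Ideal.absNorm (𝔞r c)}, rayClassCoeff 𝔪 ψ (Ideal.span {x.1})) *
        cexp (2 * π * I * (τ : ℂ)) ^ n) =
      (∑ c, coef c * ((2 * π * I) ^ e * ∑ᶠ x : {x : 𝓞 K // x ∈ 𝔞r c ∧
        Ideal.absNorm (Ideal.span {x}) = n * Ideal.absNorm (𝔞r c)}, rayClassCoeff 𝔪 ψ (Ideal.span {x.1}))) *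
        cexp (2 * π * I * (τ : ℂ)) ^ n by
    rw [Finset.sum_mul]; exact Finset.sum_congr rfl fun c _ => by ring]
  congr 1
  symm
  -- the coefficient identity
  by_cases hn : n = 0
  · subst hn
    rw [finsum_absNorm_zero, Literature.NumberTheory.LFunctions.rayClassCoeff_bot]
    refine Finset.sum_eq_zero fun c _ => ?_
    rw [finsum_eq_zero_of_forall_eq_zero, mul_zero, mul_zero]
    intro x
    have h0 : Ideal.absNorm (Ideal.span {(x.1 : 𝓞 K)}) = 0 := by simpa using x.2.2
    rw [Ideal.absNorm_eq_zero_iff.mp h0, Literature.NumberTheory.LFunctions.rayClassCoeff_bot]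
  · -- weighted class count
    have hW := sum_weighted_norm_eq hK (fun c => ⟨𝔞r c, mem_nonZeroDivisors_iff_ne_zero.mpr (h𝔞r0 c)⟩)
      (fun c => (h𝔞r c).2) hn (rayClassCoeff 𝔪 ψ)
      (fun c x => rayClassCoeff 𝔪 ψ (Ideal.span {x}) / rayClassCoeff 𝔪 ψ (𝔞r c)) ?_
    · dsimp only at hW
      calc ∑ c, coef c * ((2 * π * I) ^ e * ∑ᶠ x : {x : 𝓞 K // x ∈ 𝔞r c ∧
              Ideal.absNorm (Ideal.span {x}) = n * Ideal.absNorm (𝔞r c)}, rayClassCoeff 𝔪 ψ (Ideal.span {x.1}))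
          = (((Nat.card (𝓞 K)ˣ : ℕ) : ℂ))⁻¹ * ∑ c, ∑ᶠ x : {x : 𝓞 K // x ∈ 𝔞r c ∧
              Ideal.absNorm (Ideal.span {x}) = n * Ideal.absNorm (𝔞r c)},
              rayClassCoeff 𝔪 ψ (Ideal.span {x.1}) / rayClassCoeff 𝔪 ψ (𝔞r c) := by
            rw [Finset.mul_sum]
            refine Finset.sum_congr rfl fun c _ => ?_
            haveI : Finite {x : 𝓞 K // x ∈ 𝔞r c ∧ Ideal.absNorm (Ideal.span {x}) = n * Ideal.absNorm (𝔞r c)} :=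
              finite_norm_eq hK (𝔞r c) n
            letI : Fintype {x : 𝓞 K // x ∈ 𝔞r c ∧ Ideal.absNorm (Ideal.span {x}) = n * Ideal.absNorm (𝔞r c)} :=
              Fintype.ofFinite _
            rw [finsum_eq_sum_of_fintype, finsum_eq_sum_of_fintype, Finset.mul_sum, Finset.mul_sum,
              Finset.mul_sum]
            refine Finset.sum_congr rfl fun x _ => ?_
            rw [hcoef]
            field_simp
        _ = _ := by
            rw [hW, ← mul_assoc, inv_mul_cancel₀ hw, one_mul, finsum_subtype_absNorm_eq]
    · intro c x J hx hJ
      dsimp only at hx hJ ⊢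
      by_cases hJ0 : J = ⊥
      · subst hJ0
        rw [Ideal.mul_bot] at hJ
        rw [hJ, Literature.NumberTheory.LFunctions.rayClassCoeff_bot, zero_div]
      · have hx0 : Ideal.span {x} ≠ ⊥ := by rw [hJ]; exact mul_ne_zero (h𝔞r0 c) hJ0
        rw [hJ, rayClassCoeff_mul_of_ne_bot 𝔪 ψ (h𝔞r0 c) hJ0, mul_div_cancel_left₀ _ (hrcc0 c)]

end Summit.BirchSwinnertonDyer.BirchSwinnertonDyer.Theorems.HeckeTheta

end
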